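import Literature.AlgebraicGeometry.ProjectiveSpace.EdgeIdealPowersVertexDuplication
import HarnessLib

/-!
# The edge subring `K[G]` and perfect matchings of vertex duplications
# (Martínez-Bernal–Morey–Villarreal, Lemma 2.4)

Topic `Literature/AlgebraicGeometry/ProjectiveSpace`, namespace
`Literature.AlgebraicGeometry.ProjectiveSpace`. Lane `lit-hodgefound`, seat `lit-hodgefound-p32`,
row gen32-#12. Theorems only (no `def`, no named fact); companion of
`EdgeIdealPowersVertexDuplication.lean` (gen32-#11: the duplication `G^a` as `G.comap Sigma.fst`,
matchings of `G^a` ⟷ edges of `G` with multiplicities).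

## The source, as printed

J. Martínez-Bernal, S. Morey, R. H. Villarreal, *Associated primes of powers of edge ideals*, §2:
"Given a graph `G`, the *edge-subring* of `G` is the subring `K[G] = K[x_i x_j ∣ {x_i, x_j} ∈ E(G)]`.
**Lemma 2.4.** Let `G` be a graph with vertex set `X = {x_1, …, x_n}` and let
`a = (a_1, …, a_n) ∈ ℕ^n`. Then `G^a` has a perfect matching if and only if `x^a ∈ K[G]`.
*Proof.* … the edges of `G^a` are exactly those pairs of the form `{x_i^{k_i}, x_j^{k_j}}` with
`i ≠ j`, `k_i ≤ a_i`, `k_j ≤ a_j`, for some edge `{x_i, x_j}` of `G`. We can regard `x^a` as an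
ordered multiset … in which each variable is uniquely identified with an integer between `1` and
`|a|` …"; and Definition 2.3: "A matching that covers all the vertices of `V(G)` is called a perfect
matching of `G`."

## What is here (Mathlib currency)

* `K[G]` is `Algebra.adjoin k {x_u x_v : u ∼ v} ⊆ k[x_σ]`; § 1 shows it is the `k`-span of the
  monomials `∏_t x_{u_t} x_{v_t}` (products of edge monomials, repetitions allowed), hence a
  monomial subalgebra, and **`x^a ∈ K[G]` iff `a = ∑_t (e_{u_t} + e_{v_t})` for some edges
  `u_t v_t` of `G`** (`monomial_mem_edgeSubring_iff`).
* § 2: perfect matchings of `G^a = G.comap Sigma.fst` (vertex type `Σ v, Fin (a v)`), Mathlib's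
  `M.IsPerfectMatching`: they are the matchings with `|a|/2` edges, and **`G^a` has a perfect
  matching iff `a = ∑_t (e_{u_t} + e_{v_t})` for some edges of `G`**.
* § 3 **Lemma 2.4**: `G^a` has a perfect matching iff `x^a ∈ K[G]`; in particular (`a = (1,…,1)`,
  `G^a ≅ G`) **`G` has a perfect matching iff `x_1 ⋯ x_n ∈ K[G]`**.

## References

* [MartinezBernalMoreyVillarreal2012] J. Martínez-Bernal, S. Morey, R. H. Villarreal, *Associated
  primes of powers of edge ideals*, Collect. Math. 63 (2012) 361–374 (arXiv:1103.0992), Definition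
  2.3, Lemma 2.4.
* [CarliniEtAl2020] E. Carlini, H. T. Hà, B. Harbourne, A. Van Tuyl, *Ideals of Powers and Powers of
  Ideals*, LN UMI 27, Springer 2020, Definitions 2.23, 2.24 (matchings, duplications).
-/

noncomputable section

open Finset MvPolynomial SimpleGraph

universe u

namespace Literature.AlgebraicGeometry.ProjectiveSpace

variable {σ : Type*} [Fintype σ] [DecidableEq σ]
variable {k : Type u} [Field k]
variable (G : SimpleGraph σ)

/-! ### § 1 The edge subring `K[G] = k[x_u x_v : uv ∈ E(G)]` is spanned by monomials -/

omit [Fintype σ] [DecidableEq σ] in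
/-- The monomials of `K[G]`-generators: the multiplicative monoid generated by the edge monomials
consists of the products `∏_t x_{u_t} x_{v_t}` over finite families of edges.
[cite: MartinezBernalMoreyVillarreal2012, §2 (`K[G]`, `f^c = f_1^{c_1} ⋯ f_q^{c_q}`)] -/
theorem mem_submonoidClosure_edgeMonomials_iff (f : MvPolynomial σ k) :
    f ∈ Submonoid.closure {f : MvPolynomial σ k | ∃ u v : σ, G.Adj u v ∧ f = X u * X v} ↔
      ∃ (m : ℕ) (e : Fin m → σ × σ), (∀ t, G.Adj (e t).1 (e t).2) ∧
        f = ∏ t, (X (e t).1 * X (e t).2) := by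
  constructor
  · intro hf
    obtain ⟨l, hl, rfl⟩ := Submonoid.exists_list_of_mem_closure hf
    choose u v huv using fun i : Fin l.length => hl (l.get i) (List.get_mem l i)
    refine ⟨l.length, fun i => (u i, v i), fun i => (huv i).1, ?_⟩
    conv_lhs => rw [← List.ofFn_get l]
    rw [List.prod_ofFn]
    exact Finset.prod_congr rfl fun i _ => (huv i).2
  · rintro ⟨m, e, he, rfl⟩
    exact Submonoid.prod_mem _ fun t _ => Submonoid.subset_closure ⟨_, _, he t, rfl⟩

omit [Fintype σ] [DecidableEq σ] in
/-- **`K[G]` is the `k`-span of the monomials `x^b`, `b = ∑_t (e_{u_t} + e_{v_t})` a sum of edge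
exponents** (a subalgebra generated by monomials is spanned by their products).
[cite: MartinezBernalMoreyVillarreal2012, §2 and Lemma 2.4 (proof)] -/
theorem edgeSubring_toSubmodule_eq_span :
    Subalgebra.toSubmodule
        (Algebra.adjoin k {f : MvPolynomial σ k | ∃ u v : σ, G.Adj u v ∧ f = X u * X v}) =
      Submodule.span k ((fun b : σ →₀ ℕ => monomial b (1 : k)) ''
        {b | ∃ (m : ℕ) (e : Fin m → σ × σ), (∀ t, G.Adj (e t).1 (e t).2) ∧
          b = ∑ t, (Finsupp.single (e t).1 1 + Finsupp.single (e t).2 1)}) := by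
  rw [Algebra.adjoin_eq_span]
  congr 1
  ext f
  rw [SetLike.mem_coe, mem_submonoidClosure_edgeMonomials_iff, Set.mem_image]
  constructor
  · rintro ⟨m, e, he, rfl⟩
    exact ⟨_, ⟨m, e, he, rfl⟩, (prod_X_mul_X_eq_monomial e).symm⟩
  · rintro ⟨b, ⟨m, e, he, rfl⟩, rfl⟩
    exact ⟨m, e, he, (prod_X_mul_X_eq_monomial e).symm⟩

omit [Fintype σ] [DecidableEq σ] in
/-- A monomial lies in the `k`-span of a set of monic monomials iff it is one of them (monomials are
linearly independent). [cite: MartinezBernalMoreyVillarreal2012, Lemma 2.4 (proof)] -/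
theorem monomial_mem_submoduleSpan_monomial_image_iff (B : Set (σ →₀ ℕ)) (a : σ →₀ ℕ) :
    (monomial a (1 : k) : MvPolynomial σ k) ∈
        Submodule.span k ((fun b : σ →₀ ℕ => monomial b (1 : k)) '' B) ↔ a ∈ B := by
  classical
  rw [← MvPolynomial.restrictSupport_eq_span, MvPolynomial.mem_restrictSupport_iff,
    support_monomial, if_neg one_ne_zero, Finset.coe_singleton, Set.singleton_subset_iff]

omit [Fintype σ] [DecidableEq σ] in
/-- **Monomials of the edge subring: `x^a ∈ K[G]` iff `a = ∑_t (e_{u_t} + e_{v_t})` for some edges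
`u_1 v_1, …, u_m v_m` of `G` (repetitions allowed), i.e. iff `x^a` is a product of edge monomials.**
[cite: MartinezBernalMoreyVillarreal2012, Lemma 2.4 (proof)] -/
theorem monomial_mem_edgeSubring_iff (a : σ →₀ ℕ) :
    (monomial a (1 : k) : MvPolynomial σ k) ∈
        Algebra.adjoin k {f : MvPolynomial σ k | ∃ u v : σ, G.Adj u v ∧ f = X u * X v} ↔
      ∃ (m : ℕ) (e : Fin m → σ × σ), (∀ t, G.Adj (e t).1 (e t).2) ∧
        (∑ t, (Finsupp.single (e t).1 1 + Finsupp.single (e t).2 1) : σ →₀ ℕ) = a := by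
  rw [← Subalgebra.mem_toSubmodule, edgeSubring_toSubmodule_eq_span,
    monomial_mem_submoduleSpan_monomial_image_iff, Set.mem_setOf_eq]
  constructor
  · rintro ⟨m, e, he, h⟩
    exact ⟨m, e, he, h.symm⟩
  · rintro ⟨m, e, he, h⟩
    exact ⟨m, e, he, h.symm⟩

omit [Fintype σ] [DecidableEq σ] in
/-- The edge monomials themselves lie in `K[G]`. [cite: MartinezBernalMoreyVillarreal2012, §2] -/
theorem X_mul_X_mem_edgeSubring {u v : σ} (huv : G.Adj u v) :
    (X u * X v : MvPolynomial σ k) ∈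
      Algebra.adjoin k {f : MvPolynomial σ k | ∃ u v : σ, G.Adj u v ∧ f = X u * X v} :=
  Algebra.subset_adjoin ⟨u, v, huv, rfl⟩

omit [Fintype σ] [DecidableEq σ] in
/-- `K[G]` is a monomial subalgebra: with `f` it contains every monomial of the support of `f`.
[cite: MartinezBernalMoreyVillarreal2012, §2 and Lemma 2.4 (proof)] -/
theorem monomial_mem_edgeSubring_of_mem_support {f : MvPolynomial σ k}
    (hf : f ∈ Algebra.adjoin k {f : MvPolynomial σ k | ∃ u v : σ, G.Adj u v ∧ f = X u * X v})
    {b : σ →₀ ℕ} (hb : b ∈ f.support) :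
    (monomial b (1 : k) : MvPolynomial σ k) ∈
      Algebra.adjoin k {f : MvPolynomial σ k | ∃ u v : σ, G.Adj u v ∧ f = X u * X v} := by
  classical
  rw [← Subalgebra.mem_toSubmodule, edgeSubring_toSubmodule_eq_span,
    ← MvPolynomial.restrictSupport_eq_span, MvPolynomial.mem_restrictSupport_iff] at hf ⊢
  rw [support_monomial, if_neg one_ne_zero, Finset.coe_singleton, Set.singleton_subset_iff]
  exact hf hb

/-! ### § 2 Perfect matchings of `G^a` -/

omit [Fintype σ] [DecidableEq σ] in
/-- `m` edges have total multiplicity `2m`: `|∑_t (e_{u_t} + e_{v_t})| = 2m`.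
[cite: MartinezBernalMoreyVillarreal2012, Lemma 2.4 (proof: "Taking degrees")] -/
theorem degree_sum_single_add_single {m : ℕ} (e : Fin m → σ × σ) :
    (∑ t, (Finsupp.single (e t).1 1 + Finsupp.single (e t).2 1) : σ →₀ ℕ).degree = 2 * m := by
  rw [map_sum]
  simp only [map_add, Finsupp.degree_single, Finset.sum_const, Finset.card_univ,
    Fintype.card_fin, smul_eq_mul]
  omega

omit [Fintype σ] [DecidableEq σ] in
/-- Exponent vectors: `f ≤ g` and `|g| ≤ |f|` force `f = g` (private plumbing). [folklore] -/
private theorem finsupp_eq_of_le_of_degree_le {f g : σ →₀ ℕ} (h : f ≤ g) (hd : g.degree ≤ f.degree) :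
    f = g := by
  have hsplit : f + (g - f) = g := add_tsub_cancel_of_le h
  have hdeg : (g - f).degree = 0 := by
    have := congrArg Finsupp.degree hsplit
    rw [map_add] at this
    omega
  rw [Finsupp.degree_eq_zero_iff] at hdeg
  rw [← hsplit, hdeg, add_zero]

omit [DecidableEq σ] in
/-- **A perfect matching of `G^a` has `|a|/2` edges.**
[cite: MartinezBernalMoreyVillarreal2012, Definition 2.3 and Lemma 2.4] -/
theorem two_mul_ncard_edgeSet_eq_of_isPerfectMatching (a : σ → ℕ)
    (M : (G.comap (Sigma.fst : (Σ v : σ, Fin (a v)) → σ)).Subgraph) (hM : M.IsPerfectMatching) :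
    2 * M.edgeSet.ncard = ∑ v, a v := by
  classical
  rw [← Literature.Combinatorics.Optimization.ncard_verts_eq_two_mul_ncard_edgeSet _ M hM.1,
    Subgraph.isSpanning_iff.mp hM.2, Set.ncard_univ, Nat.card_eq_fintype_card, card_duplication]

omit [DecidableEq σ] in
/-- Conversely a matching of `G^a` with `|a|/2` edges covers all `|a|` vertices, so it is perfect.
[cite: MartinezBernalMoreyVillarreal2012, Definition 2.3 and Lemma 2.4] -/
theorem isPerfectMatching_of_two_mul_ncard_edgeSet_eq (a : σ → ℕ)
    (M : (G.comap (Sigma.fst : (Σ v : σ, Fin (a v)) → σ)).Subgraph) (hM : M.IsMatching)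
    (h : 2 * M.edgeSet.ncard = ∑ v, a v) : M.IsPerfectMatching := by
  classical
  refine ⟨hM, Subgraph.isSpanning_iff.mpr (Set.eq_of_subset_of_ncard_le (Set.subset_univ _) ?_)⟩
  rw [Set.ncard_univ, Nat.card_eq_fintype_card, card_duplication, ← h,
    Literature.Combinatorics.Optimization.ncard_verts_eq_two_mul_ncard_edgeSet _ M hM]

/-- **`G^a` has a perfect matching iff `a = ∑_t (e_{u_t} + e_{v_t})` for some edges `u_t v_t` of
`G`** (a matching using every copy exactly once).
[cite: MartinezBernalMoreyVillarreal2012, Lemma 2.4 (proof)] -/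
theorem exists_isPerfectMatching_duplication_iff (a : σ →₀ ℕ) :
    (∃ M : (G.comap (Sigma.fst : (Σ v : σ, Fin (a v)) → σ)).Subgraph, M.IsPerfectMatching) ↔
      ∃ (m : ℕ) (e : Fin m → σ × σ), (∀ t, G.Adj (e t).1 (e t).2) ∧
        (∑ t, (Finsupp.single (e t).1 1 + Finsupp.single (e t).2 1) : σ →₀ ℕ) = a := by
  constructor
  · rintro ⟨M, hM⟩
    obtain ⟨e, he, ha⟩ := exists_edges_of_isMatching_duplication G (⇑a) M hM.1 rfl
    refine ⟨M.edgeSet.ncard, e, he, finsupp_eq_of_le_of_degree_le (Finsupp.le_def.mpr ha) ?_⟩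
    rw [degree_sum_single_add_single, two_mul_ncard_edgeSet_eq_of_isPerfectMatching G (⇑a) M hM,
      Finsupp.degree_eq_sum]
  · rintro ⟨m, e, he, ha⟩
    obtain ⟨M, hM, hm⟩ := exists_isMatching_duplication_of_edges G (⇑a) e he
      fun v => Finsupp.le_def.mp ha.le v
    refine ⟨M, isPerfectMatching_of_two_mul_ncard_edgeSet_eq G (⇑a) M hM ?_⟩
    rw [hm, ← degree_sum_single_add_single e, ha, Finsupp.degree_eq_sum]

/-! ### § 3 Lemma 2.4: perfect matchings of `G^a` and `x^a ∈ K[G]` -/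

/-- **Martínez-Bernal–Morey–Villarreal, Lemma 2.4: `G^a` has a perfect matching iff `x^a ∈ K[G]`.**
[cite: MartinezBernalMoreyVillarreal2012, Lemma 2.4] -/
theorem exists_isPerfectMatching_duplication_iff_monomial_mem_edgeSubring (a : σ →₀ ℕ) :
    (∃ M : (G.comap (Sigma.fst : (Σ v : σ, Fin (a v)) → σ)).Subgraph, M.IsPerfectMatching) ↔
      (monomial a (1 : k) : MvPolynomial σ k) ∈
        Algebra.adjoin k {f : MvPolynomial σ k | ∃ u v : σ, G.Adj u v ∧ f = X u * X v} := by
  rw [exists_isPerfectMatching_duplication_iff, monomial_mem_edgeSubring_iff]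

omit [Fintype σ] [DecidableEq σ] in
/-- `G^a ≅ G` when every `a_v = 1`. [cite: CarliniEtAl2020, Definition 2.24] -/
theorem nonempty_duplication_iso_of_forall_eq_one (a : σ → ℕ) (ha : ∀ v, a v = 1) :
    Nonempty (G.comap (Sigma.fst : (Σ v : σ, Fin (a v)) → σ) ≃g G) :=
  ⟨{ toFun := Sigma.fst
     invFun := fun v => ⟨v, ⟨0, by rw [ha]; exact Nat.one_pos⟩⟩
     left_inv := fun x => by
       rcases x with ⟨v, i⟩
       have hi : (i : ℕ) = 0 := by have h : (i : ℕ) < 1 := lt_of_lt_of_eq i.2 (ha v); omega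
       exact congrArg (Sigma.mk v) (Fin.ext hi.symm)
     right_inv := fun _ => rfl
     map_rel_iff' := Iff.rfl }⟩

/-- Perfect matchings are transported along graph isomorphisms (private plumbing). [folklore] -/
private theorem isPerfectMatching_map_of_iso {V W : Type*} {G₁ : SimpleGraph V} {G₂ : SimpleGraph W}
    (ι : G₁ ≃g G₂) {M : G₁.Subgraph} (hM : M.IsPerfectMatching) :
    (M.map ι.toHom).IsPerfectMatching := by
  refine ⟨hM.1.map ι.toHom ι.injective, ?_⟩
  rw [Subgraph.isSpanning_iff, Subgraph.map_verts, Subgraph.isSpanning_iff.mp hM.2, Set.image_univ,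
    Set.range_eq_univ]
  exact fun w => ⟨ι.symm w, ι.apply_symm_apply w⟩

/-- Isomorphic graphs have perfect matchings together (private plumbing). [folklore] -/
private theorem exists_isPerfectMatching_iff_of_iso {V W : Type*} {G₁ : SimpleGraph V} {G₂ : SimpleGraph W}
    (ι : G₁ ≃g G₂) :
    (∃ M : G₁.Subgraph, M.IsPerfectMatching) ↔ ∃ M : G₂.Subgraph, M.IsPerfectMatching :=
  ⟨fun ⟨_, hM⟩ => ⟨_, isPerfectMatching_map_of_iso ι hM⟩,
    fun ⟨_, hM⟩ => ⟨_, isPerfectMatching_map_of_iso ι.symm hM⟩⟩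

/-- **`G` has a perfect matching iff `x_1 ⋯ x_n ∈ K[G]`** (Lemma 2.4 with `a = (1, …, 1)`,
`G^{(1,…,1)} ≅ G`). [cite: MartinezBernalMoreyVillarreal2012, Lemma 2.4] -/
theorem exists_isPerfectMatching_iff_prod_X_mem_edgeSubring :
    (∃ M : G.Subgraph, M.IsPerfectMatching) ↔
      (∏ v, X v : MvPolynomial σ k) ∈
        Algebra.adjoin k {f : MvPolynomial σ k | ∃ u v : σ, G.Adj u v ∧ f = X u * X v} := by
  have ha₁ : ∀ v, (Finsupp.equivFunOnFinite.symm (fun _ : σ => 1) : σ →₀ ℕ) v = 1 := fun v => rfl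
  have hprod : (monomial (Finsupp.equivFunOnFinite.symm fun _ : σ => 1) (1 : k) :
      MvPolynomial σ k) = ∏ v, X v := by
    rw [MvPolynomial.monomial_eq, C_1, one_mul, Finsupp.prod_fintype _ _ (fun i => pow_zero _)]
    exact Finset.prod_congr rfl fun v _ => by rw [ha₁, pow_one]
  obtain ⟨ι⟩ := nonempty_duplication_iso_of_forall_eq_one G _ ha₁
  rw [← hprod, ← exists_isPerfectMatching_duplication_iff_monomial_mem_edgeSubring,
    exists_isPerfectMatching_iff_of_iso ι]

end Literature.AlgebraicGeometry.ProjectiveSpace
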